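import Summits.HodgeConjecture.HodgeConjecture.Theorems.HodgeLocusCensusDenseIndex8
import Summits.HodgeConjecture.HodgeConjecture.Theorems.HodgeLocusCensusSecondComponents
import HarnessLib


/-!
# HodgeLocusCensusDenseCert8 — dense kernel-checkable rank certificates for Movasati's matrix on the Fermat CUBIC 8-fold, for ARBITRARY signed sums of linear cycles P_{a,b} (b ≠ id allowed) (cell pub-hlocus, ENGINE B seat ivhs-2, gen 8)
HONEST FRAMING: certified instances and evidence bearing on the general Hodge conjecture; no claim.

The plane-sum CORE framework of the lead (`HodgeLocusCensusCubicCert` / `…CubicRank8`) handles classes all of whose planes have the SAME matching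
b = id (the matrix is then block diagonal in the pair-sum type). The two-block pair of the Conjecture-5 witness (`HodgeLocusCensusTwoBlockRows`) mixes two
matchings, so here the 45 × 120 matrix [p_{i+j}(δ)] (rows i ∈ I₂ = weight-2 0/1-vectors of length 10, columns j ∈ I₃) is certified DENSELY:
* `HodgeLocusCensusDenseIndex8` lists I₂ / I₃ (`rowsL` / `colsL`) with `eRow : Fin 45 ≃ I₂`, `eCol : Fin 120 ≃ I₃`, so rank M_δ = rank of the reindexed
  matrix N on `Fin 45 × Fin 120` (`Matrix.rank_submatrix`);
* `PDat` = a signed plane (c·sign(b), the matching b and the twists a as lists); `entry L v ∈ ℤ[ζ₆]` (`CubicSum.Z6`) is the schema period sum of the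
  class at the exponent vector v, and `period_eq_pz` / `entry` link it to `HodgeLocus.period` / `periodComb` for ANY `LinearCycle 8` whose matching and
  twists agree with the lists (hypotheses discharged by `decide` per plane in the row file);
* `DenseCert` = (r; r pivot rows ρ and columns γ; an integral 45 × r table W with Σ_ℓ W[a,ℓ]·N[ρ_ℓ,b] = N[a,b] — so N = W·N[ρ,·] and rank N ≤ r;
  integral r × r factors A (lower triangular, positive-integer diagonal), B (upper triangular, diagonal with a norm cofactor w, B_ℓℓ·w_ℓ a positive
  integer) with A·B = N[ρ,γ] — so the minor is nonsingular in characteristic 0 and rank N ≥ r); `valid` is a Boolean decided by `decide +kernel` in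
  the data file, and `ivhsRankEq_of_cert` turns a valid certificate into the typed row `IvhsRankEq 8 3 r δ`.
Generated/checked numerics: gen8/cert83.py (fresh exact ℚ(ζ₆) arithmetic, implementation #4 of the cell) re-multiplies every certificate before
emission; the Lean kernel re-multiplies it again. Nothing here is specific to the witness classes.
-/

namespace Summit.HodgeConjecture.HodgeConjecture.HodgeLocus.Census.DenseCert8

open PlaneSum CubicSum

/-! ## Signed planes as list data and the entry function over ℤ[ζ₆] -/

/-- a signed linear cycle of X³₈ as kernel-friendly data: `c` = coefficient × sign(b), `bl` = [b 0, …, b 9] (the matching: pairs (b(2e), b(2e+1))),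
`al` = [a 0, …, a 9] (twists; only odd positions matter). -/
structure PDat where
  c : ℤ
  bl : List ℕ
  al : List ℕ

/-- [every pair sum v_{b(2e)} + v_{b(2e+1)} is d − 2 = 1] (Boolean). -/
def pairOK (bl : List ℕ) (v : ℕ → ℕ) : Bool :=
  (v (lget 0 bl 0) + v (lget 0 bl 1) == 1) && (v (lget 0 bl 2) + v (lget 0 bl 3) == 1) && (v (lget 0 bl 4) + v (lget 0 bl 5) == 1) &&
    (v (lget 0 bl 6) + v (lget 0 bl 7) == 1) && (v (lget 0 bl 8) + v (lget 0 bl 9) == 1)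

/-- the exponent Σ_e (v_{b(2e)} + 1)(1 + 2 a_{2e+1}). -/
def expo (bl al : List ℕ) (v : ℕ → ℕ) : ℕ :=
  (v (lget 0 bl 0) + 1) * (1 + 2 * lget 0 al 1) + (v (lget 0 bl 2) + 1) * (1 + 2 * lget 0 al 3) + (v (lget 0 bl 4) + 1) * (1 + 2 * lget 0 al 5) +
    (v (lget 0 bl 6) + 1) * (1 + 2 * lget 0 al 7) + (v (lget 0 bl 8) + 1) * (1 + 2 * lget 0 al 9)

/-- the schema period of the signed plane at the exponent vector v, as an element of ℤ[ζ₆]. -/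
def pz (p : PDat) (v : ℕ → ℕ) : Z6 := if pairOK p.bl v = true then Z6.smul p.c (Z6.mono (expo p.bl p.al v)) else 0

/-- the entry of [p_v(δ)] for the class δ given as a list of signed planes. -/
def entry : List PDat → (ℕ → ℕ) → Z6
  | [], _ => 0
  | p :: L, v => pz p v + entry L v

/-- k mod 10 as a coordinate index. -/
def finMod (k : ℕ) : Fin 10 := ⟨k % 10, Nat.mod_lt _ (by decide)⟩

/-- an exponent vector i : Fin 10 → ℕ read as a function on ℕ (periodically). -/
def ext (i : Fin 10 → ℕ) : ℕ → ℕ := fun k => i (finMod k)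

section link

variable {K : Type*} [Field K] (ζ : K)

/-- MV18 Thm 1 (schema normalisation) on X³₈ with the ∀ / Σ over the five pairs written out. -/
theorem period83_expand (P : LinearCycle 8) (i : Fin 10 → ℕ) :
    period 8 3 ζ P i =
      if i (P.b 0) + i (P.b 1) = 1 ∧ i (P.b 2) + i (P.b 3) = 1 ∧ i (P.b 4) + i (P.b 5) = 1 ∧ i (P.b 6) + i (P.b 7) = 1 ∧ i (P.b 8) + i (P.b 9) = 1 then
        (Equiv.Perm.sign P.b : ℤ) * ζ ^ ((i (P.b 0) + 1) * (1 + 2 * P.a 1) + (i (P.b 2) + 1) * (1 + 2 * P.a 3) + (i (P.b 4) + 1) * (1 + 2 * P.a 5) +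
          (i (P.b 6) + 1) * (1 + 2 * P.a 7) + (i (P.b 8) + 1) * (1 + 2 * P.a 9)) else 0 := by
  unfold period
  have hc : (∀ e : Fin (8 / 2 + 1), i (P.b ⟨2 * (e : ℕ), by omega⟩) + i (P.b ⟨2 * (e : ℕ) + 1, by omega⟩) = 3 - 2) ↔
      (i (P.b 0) + i (P.b 1) = 1 ∧ i (P.b 2) + i (P.b 3) = 1 ∧ i (P.b 4) + i (P.b 5) = 1 ∧ i (P.b 6) + i (P.b 7) = 1 ∧ i (P.b 8) + i (P.b 9) = 1) := by
    simp [Fin.forall_fin_succ]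
  have hs : (∑ e : Fin (8 / 2 + 1), (i (P.b ⟨2 * (e : ℕ), by omega⟩) + 1) * (1 + 2 * P.a ⟨2 * (e : ℕ) + 1, by omega⟩)) =
      (i (P.b 0) + 1) * (1 + 2 * P.a 1) + (i (P.b 2) + 1) * (1 + 2 * P.a 3) + (i (P.b 4) + 1) * (1 + 2 * P.a 5) +
          (i (P.b 6) + 1) * (1 + 2 * P.a 7) + (i (P.b 8) + 1) * (1 + 2 * P.a 9) := by
    simp [Fin.sum_univ_succ]
    ring
  simp only [hc, hs]

/-- LINK (one plane): if the matching and the twists of P agree with the lists and c = sign(b), the schema period of P at i is eval_ζ (pz ⟨c, bl, al⟩ (ext i)). -/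
theorem period_eq_pz (h2 : ζ ^ 2 = ζ - 1) (P : LinearCycle 8) (p : PDat) (hs : (Equiv.Perm.sign P.b : ℤ) = p.c)
    (hb : ∀ k : Fin 10, P.b k = finMod (lget 0 p.bl k.1)) (ha : ∀ k : Fin 10, P.a k = lget 0 p.al k.1) (i : Fin 10 → ℕ) :
    period 8 3 ζ P i = Z6.eval ζ (pz p (ext i)) := by
  rw [period83_expand, hs]
  simp only [hb, ha, Fin.val_zero, Fin.val_one, Fin.val_two, show ((3 : Fin 10) : ℕ) = 3 from rfl, show ((4 : Fin 10) : ℕ) = 4 from rfl,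
    show ((5 : Fin 10) : ℕ) = 5 from rfl, show ((6 : Fin 10) : ℕ) = 6 from rfl, show ((7 : Fin 10) : ℕ) = 7 from rfl,
    show ((8 : Fin 10) : ℕ) = 8 from rfl, show ((9 : Fin 10) : ℕ) = 9 from rfl]
  unfold pz
  by_cases hB : pairOK p.bl (ext i) = true
  · have hC : i (finMod (lget 0 p.bl 0)) + i (finMod (lget 0 p.bl 1)) = 1 ∧ i (finMod (lget 0 p.bl 2)) + i (finMod (lget 0 p.bl 3)) = 1 ∧
        i (finMod (lget 0 p.bl 4)) + i (finMod (lget 0 p.bl 5)) = 1 ∧ i (finMod (lget 0 p.bl 6)) + i (finMod (lget 0 p.bl 7)) = 1 ∧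
        i (finMod (lget 0 p.bl 8)) + i (finMod (lget 0 p.bl 9)) = 1 := by
      simpa [pairOK, ext, Bool.and_eq_true, and_assoc] using hB
    rw [if_pos hC, if_pos hB, Z6.eval_smul, Z6.eval_mono ζ h2]
    rfl
  · have hC : ¬ (i (finMod (lget 0 p.bl 0)) + i (finMod (lget 0 p.bl 1)) = 1 ∧ i (finMod (lget 0 p.bl 2)) + i (finMod (lget 0 p.bl 3)) = 1 ∧
        i (finMod (lget 0 p.bl 4)) + i (finMod (lget 0 p.bl 5)) = 1 ∧ i (finMod (lget 0 p.bl 6)) + i (finMod (lget 0 p.bl 7)) = 1 ∧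
        i (finMod (lget 0 p.bl 8)) + i (finMod (lget 0 p.bl 9)) = 1) := by
      intro h
      apply hB
      simpa [pairOK, ext, Bool.and_eq_true, and_assoc] using h
    rw [if_neg hC, if_neg hB, Z6.zero_def, Z6.eval_zero]

/-- rescaling the signed coefficient rescales the evaluation. -/
theorem eval_pz_smul (c s : ℤ) (bl al : List ℕ) (v : ℕ → ℕ) :
    Z6.eval ζ (pz ⟨c * s, bl, al⟩ v) = (c : K) * Z6.eval ζ (pz ⟨s, bl, al⟩ v) := by
  unfold pz
  split_ifs with h
  · simp only [Z6.eval_smul]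
    push_cast
    ring
  · rw [Z6.zero_def, Z6.eval_zero, mul_zero]

/-- eval of `entry` is additive along the list … -/
theorem eval_entry_cons (p : PDat) (L : List PDat) (v : ℕ → ℕ) : Z6.eval ζ (entry (p :: L) v) = Z6.eval ζ (pz p v) + Z6.eval ζ (entry L v) := by
  rw [entry, Z6.eval_add]

/-- … and the empty class evaluates to 0. -/
theorem eval_entry_nil (v : ℕ → ℕ) : Z6.eval ζ (entry [] v) = 0 := by
  rw [entry, Z6.zero_def, Z6.eval_zero]

end link

/-! ## Dense certificates -/

/-- x = 0 in ℤ[ζ₆] (Boolean). -/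
def zIsZero (x : Z6) : Bool := decide (x.c0 = 0) && decide (x.c1 = 0)

/-- soundness of the Boolean zero test. -/
theorem eq_zero_of_zIsZero {x : Z6} (h : zIsZero x = true) : x = 0 := by
  obtain ⟨c0, c1⟩ := x
  simp [zIsZero] at h
  obtain ⟨h0, h1⟩ := h
  subst h0
  subst h1
  rfl

/-- a dense rank certificate for a 45 × 120 matrix over ℤ[ζ₆]: the rank r; r pivot rows ρ (indices into `rowsL`) and columns γ (into `colsL`) in
elimination order; the row-expression table W (45 × r): row a = Σ_ℓ W[a,ℓ] · row ρ_ℓ; the integral triangular factors A (r × r, lower), B (r × r, upper)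
of the pivot minor and the norm cofactors w of B's diagonal. -/
structure DenseCert where
  r : ℕ
  rho : List ℕ
  gam : List ℕ
  W : List (List Z6)
  A : List (List Z6)
  B : List (List Z6)
  w : List Z6

namespace DenseCert

variable (Ψ : DenseCert)

/-- ρ_ℓ. -/
def rhoN (l : ℕ) : ℕ := lget 0 Ψ.rho l
/-- γ_ℓ. -/
def gamN (l : ℕ) : ℕ := lget 0 Ψ.gam l
/-- W[a, ℓ]. -/
def Wz (a l : ℕ) : Z6 := lget 0 (lget [] Ψ.W a) l
/-- A[h, ℓ]. -/
def Az (h l : ℕ) : Z6 := lget 0 (lget [] Ψ.A h) l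
/-- B[ℓ, g]. -/
def Bz (l g : ℕ) : Z6 := lget 0 (lget [] Ψ.B l) g
/-- w_ℓ. -/
def wz (l : ℕ) : Z6 := lget 0 Ψ.w l

/-- the ℓ-th term of row a's expression (zero coefficients short-circuit, so the kernel skips the entry evaluation). -/
def uterm (L : List PDat) (a b l : ℕ) : Z6 := if zIsZero (Ψ.Wz a l) = true then 0 else Ψ.Wz a l * entry L (vab (Ψ.rhoN l) b)

/-- (U) every row is the tabulated combination of the pivot rows: Σ_ℓ W[a,ℓ] N[ρ_ℓ, b] = N[a, b]. -/
def validU (L : List PDat) : Bool :=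
  Z8.allLT 45 fun a => Z8.allLT 120 fun b => decide (Z6.rsum Ψ.r (Ψ.uterm L a b) = entry L (vab a b))
/-- (L) the factors re-multiply to the pivot minor: Σ_ℓ A[h,ℓ] B[ℓ,g] = N[ρ_h, γ_g]. -/
def validL (L : List PDat) : Bool :=
  Z8.allLT Ψ.r fun h => Z8.allLT Ψ.r fun g => decide (Z6.rsum Ψ.r (fun l => Ψ.Az h l * Ψ.Bz l g) = entry L (vab (Ψ.rhoN h) (Ψ.gamN g)))
/-- (T) A is lower and B upper triangular. -/
def validT : Bool :=
  Z8.allLT Ψ.r fun h => Z8.allLT Ψ.r fun l => (!decide (h < l) || zIsZero (Ψ.Az h l)) && (!decide (l < h) || zIsZero (Ψ.Bz h l))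
/-- (P) pivots: A_ℓℓ a positive integer, B_ℓℓ · w_ℓ a positive integer, and the pivot indices are in range. -/
def validP : Bool :=
  Z8.allLT Ψ.r fun l => (Ψ.Az l l).isPosConst && (Ψ.Bz l l * Ψ.wz l).isPosConst && decide (Ψ.rhoN l < 45) && decide (Ψ.gamN l < 120)
/-- the whole certificate check. -/
def valid (L : List PDat) : Bool := Ψ.validU L && Ψ.validL L && Ψ.validT && Ψ.validP

variable {Ψ} {L : List PDat}

/-- (U) unfolded. -/
theorem U_eq (h : Ψ.valid L = true) {a b : ℕ} (ha : a < 45) (hb : b < 120) : Z6.rsum Ψ.r (Ψ.uterm L a b) = entry L (vab a b) := by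
  have h1 : Ψ.validU L = true := by
    simp only [valid, Bool.and_eq_true] at h
    exact h.1.1.1
  unfold validU at h1
  rw [Z8.allLT_iff] at h1
  have h2 := h1 a ha
  rw [Z8.allLT_iff] at h2
  exact of_decide_eq_true (h2 b hb)

/-- (L) unfolded. -/
theorem L_eq (h : Ψ.valid L = true) {h' g : ℕ} (hh : h' < Ψ.r) (hg : g < Ψ.r) :
    Z6.rsum Ψ.r (fun l => Ψ.Az h' l * Ψ.Bz l g) = entry L (vab (Ψ.rhoN h') (Ψ.gamN g)) := by
  have h1 : Ψ.validL L = true := by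
    simp only [valid, Bool.and_eq_true] at h
    exact h.1.1.2
  unfold validL at h1
  rw [Z8.allLT_iff] at h1
  have h2 := h1 h' hh
  rw [Z8.allLT_iff] at h2
  exact of_decide_eq_true (h2 g hg)

/-- (T) A above the diagonal vanishes … -/
theorem A_upper_zero (h : Ψ.valid L = true) {h' l : ℕ} (hh : h' < Ψ.r) (hl : l < Ψ.r) (hlt : h' < l) : Ψ.Az h' l = 0 := by
  have h1 : Ψ.validT = true := by
    simp only [valid, Bool.and_eq_true] at h
    exact h.1.2
  unfold validT at h1
  rw [Z8.allLT_iff] at h1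
  have h2 := h1 h' hh
  rw [Z8.allLT_iff] at h2
  have h3 := h2 l hl
  simp only [Bool.and_eq_true, Bool.or_eq_true, Bool.not_eq_true', decide_eq_false_iff_not] at h3
  rcases h3.1 with h4 | h4
  · exact absurd hlt h4
  · exact eq_zero_of_zIsZero h4

/-- … and B below the diagonal. -/
theorem B_lower_zero (h : Ψ.valid L = true) {h' l : ℕ} (hh : h' < Ψ.r) (hl : l < Ψ.r) (hlt : l < h') : Ψ.Bz h' l = 0 := by
  have h1 : Ψ.validT = true := by
    simp only [valid, Bool.and_eq_true] at h
    exact h.1.2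
  unfold validT at h1
  rw [Z8.allLT_iff] at h1
  have h2 := h1 h' hh
  rw [Z8.allLT_iff] at h2
  have h3 := h2 l hl
  simp only [Bool.and_eq_true, Bool.or_eq_true, Bool.not_eq_true', decide_eq_false_iff_not] at h3
  rcases h3.2 with h4 | h4
  · exact absurd hlt h4
  · exact eq_zero_of_zIsZero h4

/-- (P) unfolded. -/
theorem pivots (h : Ψ.valid L = true) {l : ℕ} (hl : l < Ψ.r) :
    (Ψ.Az l l).isPosConst = true ∧ (Ψ.Bz l l * Ψ.wz l).isPosConst = true ∧ Ψ.rhoN l < 45 ∧ Ψ.gamN l < 120 := by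
  have h1 : Ψ.validP = true := by
    simp only [valid, Bool.and_eq_true] at h
    exact h.2
  unfold validP at h1
  rw [Z8.allLT_iff] at h1
  have h2 := h1 l hl
  simp only [Bool.and_eq_true, decide_eq_true_eq] at h2
  exact ⟨h2.1.1.1, h2.1.1.2, h2.1.2, h2.2⟩

end DenseCert

/-! ## Soundness: a valid dense certificate decides the row -/

section sound

variable {K : Type*} [Field K] (ζ : K) {L : List PDat} (δ : List (ℚ × LinearCycle 8)) {Ψ : DenseCert}

/-- the reindexed matrix N[a, b] = M_δ[rows[a], cols[b]]. -/
noncomputable def N : Matrix (Fin 45) (Fin 120) K := (ivhsMatrix 8 3 ζ δ).submatrix eRow eCol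

variable {δ}

/-- entries of N from the entry function (given the class link). -/
theorem N_apply (hE : ∀ i : Fin 10 → ℕ, periodComb 8 3 ζ δ i = Z6.eval ζ (entry L (ext i))) (a : Fin 45) (b : Fin 120) :
    N ζ δ a b = Z6.eval ζ (entry L (vab a.1 b.1)) := by
  unfold N
  rw [Matrix.submatrix_apply]
  unfold ivhsMatrix
  rw [hE]
  rfl

/-- UPPER BOUND: rank N ≤ r (N = W · N[ρ, ·]). -/
theorem rank_N_le (h2 : ζ ^ 2 = ζ - 1) (hE : ∀ i : Fin 10 → ℕ, periodComb 8 3 ζ δ i = Z6.eval ζ (entry L (ext i))) (hV : Ψ.valid L = true) :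
    (N ζ δ).rank ≤ Ψ.r := by
  let ρf : Fin Ψ.r → Fin 45 := fun l => ⟨Ψ.rhoN l.1, (DenseCert.pivots hV l.2).2.2.1⟩
  let Wm : Matrix (Fin 45) (Fin Ψ.r) K := fun a l => Z6.eval ζ (Ψ.Wz a.1 l.1)
  have hfac : N ζ δ = Wm * (N ζ δ).submatrix ρf id := by
    ext a b
    rw [Matrix.mul_apply, N_apply ζ hE]
    have hu := congrArg (Z6.eval ζ) (DenseCert.U_eq hV a.2 b.2)
    rw [Z6.eval_rsum, Finset.sum_range] at hu
    rw [← hu]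
    refine Finset.sum_congr rfl fun l _ => ?_
    rw [Matrix.submatrix_apply, id, N_apply ζ hE]
    unfold DenseCert.uterm
    split_ifs with hz
    · show Z6.eval ζ 0 = Z6.eval ζ (Ψ.Wz a.1 l.1) * Z6.eval ζ (entry L (vab (Ψ.rhoN l.1) b.1))
      rw [eq_zero_of_zIsZero hz, Z6.zero_def, Z6.eval_zero, zero_mul]
    · rw [Z6.eval_mul ζ h2]
  rw [hfac]
  exact (Matrix.rank_mul_le_right _ _).trans ((Matrix.rank_le_card_height _).trans (by simp))

/-- LOWER BOUND: r ≤ rank N (the pivot minor factors as lower × upper triangular with nonzero diagonals). -/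
theorem le_rank_N [CharZero K] (h2 : ζ ^ 2 = ζ - 1) (hE : ∀ i : Fin 10 → ℕ, periodComb 8 3 ζ δ i = Z6.eval ζ (entry L (ext i)))
    (hV : Ψ.valid L = true) : Ψ.r ≤ (N ζ δ).rank := by
  classical
  let ρf : Fin Ψ.r → Fin 45 := fun l => ⟨Ψ.rhoN l.1, (DenseCert.pivots hV l.2).2.2.1⟩
  let γf : Fin Ψ.r → Fin 120 := fun l => ⟨Ψ.gamN l.1, (DenseCert.pivots hV l.2).2.2.2⟩
  let Am : Matrix (Fin Ψ.r) (Fin Ψ.r) K := fun h l => Z6.eval ζ (Ψ.Az h.1 l.1)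
  let Bm : Matrix (Fin Ψ.r) (Fin Ψ.r) K := fun l g => Z6.eval ζ (Ψ.Bz l.1 g.1)
  have hS : (N ζ δ).submatrix ρf γf = Am * Bm := by
    ext h g
    rw [Matrix.mul_apply, Matrix.submatrix_apply, N_apply ζ hE]
    have hl := congrArg (Z6.eval ζ) (DenseCert.L_eq hV h.2 g.2)
    rw [Z6.eval_rsum, Finset.sum_range] at hl
    rw [← hl]
    exact Finset.sum_congr rfl fun l _ => Z6.eval_mul ζ h2 _ _
  have hAt : Am.BlockTriangular OrderDual.toDual := by
    intro h l hlt
    have hlt' : h < l := OrderDual.toDual_lt_toDual.mp hlt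
    show Z6.eval ζ (Ψ.Az h.1 l.1) = 0
    rw [DenseCert.A_upper_zero hV h.2 l.2 hlt', Z6.zero_def, Z6.eval_zero]
  have hAd : ∀ l : Fin Ψ.r, Am l l ≠ 0 := fun l => Z6.eval_ne_zero_of_posConst ζ (DenseCert.pivots hV l.2).1
  have hBt : Bm.BlockTriangular id := by
    intro l g hlt
    have hlt' : g < l := hlt
    show Z6.eval ζ (Ψ.Bz l.1 g.1) = 0
    rw [DenseCert.B_lower_zero hV l.2 g.2 hlt', Z6.zero_def, Z6.eval_zero]
  have hBd : ∀ l : Fin Ψ.r, Bm l l ≠ 0 := by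
    intro l
    have hw := Z6.eval_ne_zero_of_posConst ζ (DenseCert.pivots hV l.2).2.1
    rw [Z6.eval_mul ζ h2] at hw
    exact left_ne_zero_of_mul hw
  have hdet : IsUnit ((N ζ δ).submatrix ρf γf).det := by
    rw [hS, Matrix.det_mul, Matrix.det_of_lowerTriangular _ hAt, Matrix.det_of_upperTriangular hBt]
    exact isUnit_iff_ne_zero.mpr (mul_ne_zero (Finset.prod_ne_zero_iff.mpr fun l _ => hAd l) (Finset.prod_ne_zero_iff.mpr fun l _ => hBd l))
  have hrank : ((N ζ δ).submatrix ρf γf).rank = Ψ.r := by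
    rw [Matrix.rank_of_isUnit _ ((Matrix.isUnit_iff_isUnit_det _).mpr hdet), Fintype.card_fin]
  calc Ψ.r = ((N ζ δ).submatrix ρf γf).rank := hrank.symm
    _ ≤ (N ζ δ).rank := Matrix.rank_submatrix_le _ _ _

end sound

/-- MAIN THEOREM: a class link `periodComb 8 3 ζ δ = eval_ζ ∘ entry L ∘ ext` (for every characteristic-0 field with ζ² = ζ − 1) and a valid dense
certificate for L decide the census row `IvhsRankEq 8 3 r δ`. -/
theorem ivhsRankEq_of_cert (L : List PDat) (δ : List (ℚ × LinearCycle 8))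
    (hE : ∀ (K : Type) [Field K] (ζ : K), ζ ^ 2 = ζ - 1 → ∀ i : Fin 10 → ℕ, periodComb 8 3 ζ δ i = Z6.eval ζ (entry L (ext i)))
    (Ψ : DenseCert) (hV : Ψ.valid L = true) : IvhsRankEq 8 3 Ψ.r δ := by
  intro K _ _ ζ hζ
  have h2 : ζ ^ 2 = ζ - 1 := (primRoot6_facts ζ hζ).2.2
  rw [← Matrix.rank_submatrix (ivhsMatrix 8 3 ζ δ) eRow eCol]
  exact le_antisymm (rank_N_le ζ h2 (hE K ζ h2) hV) (le_rank_N ζ h2 (hE K ζ h2) hV)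

end Summit.HodgeConjecture.HodgeConjecture.HodgeLocus.Census.DenseCert8
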